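/-
Copyright (c) 2026. All rights reserved.
Released under Apache 2.0 license as described in the file LICENSE.
Authors: abc-iut cell, statement-typer seat abc-iut-L4-t3 (wave 1).
-/
import Literature.AnabelianGeometry.AbsoluteAnabelian.ArithmeticLineBundlesModels

/-!
# [AbsTopIII] Definition 5.3 (ii), last paragraph: the equivalence `Th⊚⊞_T ⥲ Th⊚⊠_T` — DISCHARGE of `AddMulLineBundleCategoriesEquivalent`

S. Mochizuki, *Topics in absolute anabelian geometry III* [MochizukiAbsTopIII2015], Def 5.3 (ii) p. 124: the
assignment `L⊞[⊚] ↦ (the (M⊚_{TLG})^Π-torsor of nonzero sections of L⊞[⊚] ⊗ (M⊚)^Π)` "determines [in an evident fashion]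
an equivalence of categories `Th⊚⊞_T ⥲ Th⊚⊠_T`". This file PROVES the named fact `AddMulLineBundleCategoriesEquivalent F`
of `ArithmeticLineBundles.lean` (seat abc-iut-L4-t3; the trivial-`Out(Π)`-twist case over a Mathlib number field `F`) by
the printed construction, in coordinates: with a model `(x₀, c, J)` of `L⊞` (`ArithmeticLineBundlesModels.lean`) the
nonzero sections of `L⊞[⊚] ⊗ F = F · x₀` form the torsor `F^×`, trivialised at a finite `v` by
`τ[v](a) = ord_v(a) − count_v(J)` (the order of `a · x₀` relative to `L⊞ ⊗ 𝒪_v`) and at an archimedean `v` by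
`τ[v](a) = −log|a|_v − log|x₀|_v`; a morphism `f` acts on the torsors by the nonzero constant `c₂(f x₁)`; the functor is
full (orders detect containment, `ArithmeticLineBundlesOrders.lean`), faithful (a morphism is determined by its value at
`x₀`, `ArithmeticLineBundlesCoordinates.lean`) and essentially surjective (a `⊠`-line bundle with base point `t₀` comes
from the fractional ideal `∏ v^{−τ[v](t₀)}` with the metrics `|·|_v · e^{−τ[v](t₀)}`). Proof-only. Refereed pre-IUT
material; nothing here bears on [IUTchIII] Cor. 3.12 (an elementary statement, kernel-checked; not a disputed claim).
-/

set_option autoImplicit false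

noncomputable section

open NumberField IsDedekindDomain FractionalIdeal
open scoped nonZeroDivisors

namespace Literature.AnabelianGeometry.AbsoluteAnabelian

variable (F : Type) [Field F] [NumberField F]

/-- **Def 5.3 (ii), last paragraph — DISCHARGED**: the categories of `⊞`- and `⊠`-line bundles on `F` are equivalent
(the named fact `AddMulLineBundleCategoriesEquivalent F` holds). [cite: MochizukiAbsTopIII2015, Def 5.3 (ii) p. 124] -/
theorem addMulLineBundleCategoriesEquivalent_holds : AddMulLineBundleCategoriesEquivalent F := by
  classical
  -- models of the `⊞`-line bundles
  choose x₀ c J hx₀ hc hJ0 hJmem using fun L : AddLineBundle F => L.exists_model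
  -- the trivializations of `Φ L`
  let τn : ∀ L : AddLineBundle F, HeightOneSpectrum (𝓞 F) → Fˣ → ℤ :=
    fun L v t => ordAt F v t - count F v (J L)
  let τa : ∀ L : AddLineBundle F, InfinitePlace F → Fˣ → ℝ :=
    fun L v t => negLogAt F v t - Real.log (L.norm v (x₀ L))
  -- `ord_v` and `-log|·|_v` are additive on `F^×`
  have hord_mul : ∀ (v : HeightOneSpectrum (𝓞 F)) (a t : Fˣ), ordAt F v (a * t) = ordAt F v a + ordAt F v t :=
    fun v a t => (MulLineBundle.trivial F).τnon_smul v a t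
  have hneg_mul : ∀ (v : InfinitePlace F) (a t : Fˣ), negLogAt F v (a * t) = negLogAt F v a + negLogAt F v t :=
    fun v a t => (MulLineBundle.trivial F).τarc_smul v a t
  have hτn_smul : ∀ (L : AddLineBundle F) (v : HeightOneSpectrum (𝓞 F)) (a t : Fˣ),
      τn L v (a • t) = ordAt F v a + τn L v t := by
    intro L v a t
    simp only [τn, smul_eq_mul]
    rw [hord_mul v a t]
    ring
  have hτa_smul : ∀ (L : AddLineBundle F) (v : InfinitePlace F) (a t : Fˣ),
      τa L v (a • t) = negLogAt F v a + τa L v t := by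
    intro L v a t
    simp only [τa, smul_eq_mul]
    rw [hneg_mul v a t]
    ring
  have hτn_fin : ∀ (L : AddLineBundle F) (t : Fˣ), {v | τn L v t ≠ 0}.Finite := by
    intro L t
    refine ((MulLineBundle.finite_setOf_ordAt_ne_zero t).union
      (Filter.eventually_cofinite.mp (finite_factors (J L)))).subset ?_
    intro v hv
    by_contra h
    simp only [Set.mem_union, Set.mem_setOf_eq] at h
    push Not at h
    exact hv (by simp only [τn]; rw [h.1, h.2, sub_zero])
  let Φ : AddLineBundle F → MulLineBundle F := fun L =>
    { T := Fˣ
      nonempty := ⟨1⟩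
      bijective_smul := (MulLineBundle.trivial F).bijective_smul
      τnon := τn L
      τnon_smul := hτn_smul L
      τarc := τa L
      τarc_smul := hτa_smul L
      finite_support := hτn_fin L }
  -- the constant of a morphism
  have he : ∀ {L₁ L₂ : AddLineBundle F} (f : AddLineBundle.Hom L₁ L₂), c L₂ (f.toLinearMap (x₀ L₁)) ≠ 0 :=
    fun {L₁ L₂} f => AddLineBundle.coordinate_hom_ne_zero (hx₀ L₁) (hx₀ L₂) (c L₂) (hc L₂) f
  -- orders along a morphism
  have hcount : ∀ {L₁ L₂ : AddLineBundle F} (f : AddLineBundle.Hom L₁ L₂) (v : HeightOneSpectrum (𝓞 F)),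
      count F v (J L₂) ≤ Literature.IUT.LogVolume.ord F v (c L₂ (f.toLinearMap (x₀ L₁))) + count F v (J L₁) := by
    intro L₁ L₂ f v
    rw [← LineBundleOrders.count_spanSingleton_mul F v (he f) (hJ0 L₁)]
    refine count_mono F v (mul_ne_zero (spanSingleton_ne_zero_iff.mpr (he f)) (hJ0 L₁)) ?_
    rw [mul_le]
    intro i hi j hj
    obtain ⟨z, rfl⟩ := (mem_spanSingleton (𝓞 F)⁰).mp hi
    obtain ⟨y, rfl⟩ := (hJmem L₁ j).mp hj
    refine (hJmem L₂ _).mpr ⟨f.toLinearMap (z • y), ?_⟩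
    rw [map_smul, map_smul, AddLineBundle.coordinate_hom (hx₀ L₁) (c L₁) (hc L₁) (c L₂) f y, Algebra.smul_def,
      Algebra.smul_def]
    ring
  -- archimedean contraction along a morphism
  have hlog : ∀ {L₁ L₂ : AddLineBundle F} (f : AddLineBundle.Hom L₁ L₂) (v : InfinitePlace F),
      Real.log (v (c L₂ (f.toLinearMap (x₀ L₁)))) + Real.log (L₂.norm v (x₀ L₂)) ≤
        Real.log (L₁.norm v (x₀ L₁)) := by
    intro L₁ L₂ f v
    have h1 := f.norm_le v (x₀ L₁)
    rw [AddLineBundle.norm_hom_basePoint (hx₀ L₂) (c L₂) (hc L₂) f v (x₀ L₁)] at h1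
    have hpos : 0 < v (c L₂ (f.toLinearMap (x₀ L₁))) := (InfinitePlace.pos_iff).mpr (he f)
    have hpos₂ : 0 < L₂.norm v (x₀ L₂) := L₂.norm_pos v (hx₀ L₂)
    rw [← Real.log_mul hpos.ne' hpos₂.ne']
    exact Real.log_le_log (mul_pos hpos hpos₂) h1
  -- the functor on morphisms
  let u : ∀ {L₁ L₂ : AddLineBundle F}, AddLineBundle.Hom L₁ L₂ → Fˣ := fun {L₁ L₂} f => Units.mk0 _ (he f)
  have hΦτnon : ∀ {L₁ L₂ : AddLineBundle F} (f : AddLineBundle.Hom L₁ L₂) (v : HeightOneSpectrum (𝓞 F)) (t : Fˣ),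
      τn L₁ v t ≤ τn L₂ v (t * u f) := by
    intro L₁ L₂ f v t
    have h1 : ordAt F v (t * u f) = ordAt F v t + ordAt F v (u f) := hord_mul v t (u f)
    have h2 : ordAt F v (u f) = Literature.IUT.LogVolume.ord F v (c L₂ (f.toLinearMap (x₀ L₁))) := rfl
    have h3 := hcount f v
    simp only [τn]
    rw [h1, h2]
    linarith
  have hΦτarc : ∀ {L₁ L₂ : AddLineBundle F} (f : AddLineBundle.Hom L₁ L₂) (v : InfinitePlace F) (t : Fˣ),
      τa L₁ v t ≤ τa L₂ v (t * u f) := by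
    intro L₁ L₂ f v t
    have h1 : negLogAt F v (t * u f) = negLogAt F v t + negLogAt F v (u f) := hneg_mul v t (u f)
    have h2 : negLogAt F v (u f) = -Real.log (v (c L₂ (f.toLinearMap (x₀ L₁)))) := rfl
    have h3 := hlog f v
    simp only [τa]
    rw [h1, h2]
    linarith
  let Φmap : ∀ {L₁ L₂ : AddLineBundle F}, AddLineBundle.Hom L₁ L₂ → MulLineBundle.Hom (Φ L₁) (Φ L₂) :=
    fun {L₁ L₂} f =>
      { toEquiv := Equiv.mulRight (u f)
        map_smul := fun a t => mul_assoc a t (u f)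
        τnon_le := fun v t => hΦτnon f v t
        τarc_le := fun v t => hΦτarc f v t }
  have hΦmap_apply : ∀ {L₁ L₂ : AddLineBundle F} (f : AddLineBundle.Hom L₁ L₂) (t : Fˣ),
      (Φmap f).toEquiv t = t * u f := fun f t => rfl
  refine ⟨Φ, Φmap, fun L => ?_, fun {L₁ L₂ L₃} f g => ?_, fun L₁ L₂ => ⟨fun f f' hff' => ?_, fun ζ => ?_⟩, fun M => ?_⟩
  · -- identities
    refine Equiv.ext fun t => ?_
    rw [hΦmap_apply]
    change t * u (AddLineBundle.Hom.id L) = t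
    have h1 : u (AddLineBundle.Hom.id L) = 1 := Units.ext (by
      change c L (LinearMap.id (x₀ L)) = 1
      rw [LinearMap.id_apply, hc L])
    rw [h1, mul_one]
  · -- composition
    refine Equiv.ext fun t => ?_
    rw [hΦmap_apply]
    change t * u (f.comp g) = (t * u f) * u g
    have h1 : (u (f.comp g) : F) = u f * u g := by
      change c L₃ (g.toLinearMap (f.toLinearMap (x₀ L₁))) =
        c L₂ (f.toLinearMap (x₀ L₁)) * c L₃ (g.toLinearMap (x₀ L₂))
      rw [AddLineBundle.coordinate_hom (hx₀ L₂) (c L₂) (hc L₂) (c L₃) g (f.toLinearMap (x₀ L₁)), mul_comm]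
    have hu : u (f.comp g) = u f * u g := Units.ext (h1.trans (Units.val_mul _ _).symm)
    rw [hu, mul_assoc]
  · -- faithful
    have h1 : (Φmap f).toEquiv 1 = (Φmap f').toEquiv 1 :=
      congrArg (fun ζ : MulLineBundle.Hom (Φ L₁) (Φ L₂) => ζ.toEquiv 1) hff'
    rw [hΦmap_apply, hΦmap_apply, one_mul, one_mul] at h1
    have h2 : c L₂ (f.toLinearMap (x₀ L₁)) = c L₂ (f'.toLinearMap (x₀ L₁)) := by
      have := congrArg (fun w : Fˣ => (w : F)) h1
      exact this
    have h3 : f.toLinearMap (x₀ L₁) = f'.toLinearMap (x₀ L₁) := AddLineBundle.coordinate_injective L₂ (hx₀ L₂) (c L₂) (hc L₂) h2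
    exact AddLineBundle.Hom.ext' (AddLineBundle.hom_toLinearMap_ext (hx₀ L₁) f f' h3)
  · -- full
    set w : Fˣ := ζ.toEquiv 1 with hw
    have hζ : ∀ t : Fˣ, ζ.toEquiv t = t * w := by
      intro t
      have := ζ.map_smul t 1
      rw [smul_eq_mul, mul_one] at this
      rw [this]; rfl
    have hw0 : (w : F) ≠ 0 := w.ne_zero
    -- finite places: `w • J L₁ ⊆ J L₂`
    have hle : spanSingleton (𝓞 F)⁰ (w : F) * J L₁ ≤ J L₂ := by
      refine LineBundleOrders.le_of_count_le (mul_ne_zero (spanSingleton_ne_zero_iff.mpr hw0) (hJ0 L₁)) (hJ0 L₂)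
        fun v => ?_
      rw [LineBundleOrders.count_spanSingleton_mul F v hw0 (hJ0 L₁)]
      have h1 := ζ.τnon_le v 1
      rw [hζ 1, one_mul] at h1
      change τn L₁ v 1 ≤ τn L₂ v w at h1
      simp only [τn] at h1
      have h2 : ordAt F v (1 : Fˣ) = 0 := Literature.IUT.LogVolume.ord_one F v
      have h3 : ordAt F v w = Literature.IUT.LogVolume.ord F v (w : F) := rfl
      linarith
    have hrange : ∀ y : L₁.L, ∃ z : L₂.L, c L₂ z = (w : F) * c L₁ y := by
      intro y
      have hmem : (w : F) * c L₁ y ∈ J L₂ :=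
        hle (mul_mem_mul ((mem_spanSingleton_self (𝓞 F)⁰ (w : F))) ((hJmem L₁ _).mpr ⟨y, rfl⟩))
      exact (hJmem L₂ _).mp hmem
    -- archimedean places: `|w|_v · |x₂|_v ≤ |x₁|_v`
    have hnorm : ∀ v : InfinitePlace F, v (w : F) * L₂.norm v (x₀ L₂) ≤ L₁.norm v (x₀ L₁) := by
      intro v
      have h1 := ζ.τarc_le v 1
      rw [hζ 1, one_mul] at h1
      change τa L₁ v 1 ≤ τa L₂ v w at h1
      simp only [τa, negLogAt, Units.val_one, map_one, Real.log_one, neg_zero, zero_sub] at h1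
      have hpos : 0 < v (w : F) := (InfinitePlace.pos_iff).mpr hw0
      have hpos₁ : 0 < L₁.norm v (x₀ L₁) := L₁.norm_pos v (hx₀ L₁)
      have hpos₂ : 0 < L₂.norm v (x₀ L₂) := L₂.norm_pos v (hx₀ L₂)
      rw [← Real.log_le_log_iff (mul_pos hpos hpos₂) hpos₁, Real.log_mul hpos.ne' hpos₂.ne']
      linarith
    obtain ⟨f, hf⟩ := AddLineBundle.exists_hom_of_const (hx₀ L₁) (hx₀ L₂) (c L₁) (hc L₁) (c L₂) (hc L₂) hw0
      hrange hnorm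
    refine ⟨f, MulLineBundle.Hom.ext' (Equiv.ext fun t => ?_)⟩
    rw [hΦmap_apply, hζ t]
    have h1 : u f = w := Units.ext hf
    rw [h1]
  · -- essentially surjective
    obtain ⟨t₀⟩ := M.nonempty
    have hfin : ∀ᶠ v : HeightOneSpectrum (𝓞 F) in Filter.cofinite, -M.τnon v t₀ = 0 := by
      refine (M.finite_support t₀).subset fun v hv => ?_
      simpa using hv
    obtain ⟨L, ι, hι, hmemι, ⟨y₁, hy₁⟩, hnormι⟩ :=
      AddLineBundle.exists_of_orders (F := F) (fun v => -M.τnon v t₀) hfin (fun v => -M.τarc v t₀)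
    -- the model of `L` versus `ι`
    set d₀ : F := ι (x₀ L) with hd₀
    have hd₀0 : d₀ ≠ 0 := fun h => hx₀ L (hι (by rw [← hd₀, h, map_zero]))
    have hcι : ∀ y : L.L, c L y = d₀⁻¹ * ι y := by
      intro y
      have h1 : c L = d₀⁻¹ • ι :=
        L.coordinate_unique (hx₀ L) (c L) (d₀⁻¹ • ι) (hc L) (by
          rw [LinearMap.smul_apply, ← hd₀, smul_eq_mul, inv_mul_cancel₀ hd₀0])
      rw [h1, LinearMap.smul_apply, smul_eq_mul]
    let d₀u : Fˣ := Units.mk0 d₀ hd₀0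
    -- the fractional ideal of coordinates of `L` is `d₀⁻¹ · ∏ v^{-τ_v(t₀)}`
    have hJL : J L = spanSingleton (𝓞 F)⁰ d₀⁻¹ *
        ∏ᶠ v : HeightOneSpectrum (𝓞 F), (v.asIdeal : FractionalIdeal (𝓞 F)⁰ F) ^ (-M.τnon v t₀) := by
      apply FractionalIdeal.ext
      intro a
      rw [hJmem L a, mem_singleton_mul]
      constructor
      · rintro ⟨y, rfl⟩
        refine ⟨ι y, ?_, by rw [hcι y]⟩
        by_cases hy : ι y = 0
        · rw [hy]; exact zero_mem _
        · exact (LineBundleOrders.mem_finprod_zpow_iff _ hfin hy).mpr (((hmemι (ι y) hy).mp ⟨y, rfl⟩))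
      · rintro ⟨b, hb, rfl⟩
        by_cases hb0 : b = 0
        · exact ⟨0, by rw [map_zero, hb0, mul_zero]⟩
        · obtain ⟨y, hy⟩ := (hmemι b hb0).mpr ((LineBundleOrders.mem_finprod_zpow_iff _ hfin hb0).mp hb)
          exact ⟨y, by rw [hcι y, hy]⟩
    have hcountJL : ∀ v : HeightOneSpectrum (𝓞 F),
        count F v (J L) = -Literature.IUT.LogVolume.ord F v d₀ + -M.τnon v t₀ := by
      intro v
      rw [hJL, LineBundleOrders.count_spanSingleton_mul F v (inv_ne_zero hd₀0) (LineBundleOrders.finprod_zpow_ne_zero _),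
        count_finprod F v _ hfin, Literature.IUT.LogVolume.ord_inv]
    -- the trivializations of `Φ L` and of `M` agree along `a ↦ (a · d₀) • t₀`
    have hτn_eq : ∀ (v : HeightOneSpectrum (𝓞 F)) (a : Fˣ), τn L v a = M.τnon v ((a * d₀u) • t₀) := by
      intro v a
      simp only [τn]
      rw [hcountJL v, M.τnon_smul v (a * d₀u) t₀, hord_mul v a d₀u]
      have h1 : ordAt F v d₀u = Literature.IUT.LogVolume.ord F v d₀ := rfl
      rw [h1]
      ring
    have hτa_eq : ∀ (v : InfinitePlace F) (a : Fˣ), τa L v a = M.τarc v ((a * d₀u) • t₀) := by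
      intro v a
      simp only [τa]
      rw [M.τarc_smul v (a * d₀u) t₀, hneg_mul v a d₀u, hnormι v (x₀ L), ← hd₀]
      have h1 : negLogAt F v d₀u = -Real.log (v d₀) := rfl
      have hpos : 0 < v d₀ := (InfinitePlace.pos_iff).mpr hd₀0
      rw [h1, Real.log_mul hpos.ne' (Real.exp_ne_zero _), Real.log_exp]
      ring
    -- the isomorphism of torsors
    let E : Fˣ ≃ M.T := (Equiv.mulRight d₀u).trans (Equiv.ofBijective (fun a : Fˣ => a • t₀) (M.bijective_smul t₀))
    have hE : ∀ a : Fˣ, E a = (a * d₀u) • t₀ := fun a => rfl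
    have hE_smul : ∀ a t : Fˣ, E (a • t) = a • E t := by
      intro a t
      rw [hE, hE, smul_eq_mul, mul_assoc, mul_smul]
    have hEsymm_smul : ∀ (a : Fˣ) (s : M.T), E.symm (a • s) = a • E.symm s := by
      intro a s
      apply E.injective
      rw [Equiv.apply_symm_apply, hE_smul, Equiv.apply_symm_apply]
    let e₁ : MulLineBundle.Hom (Φ L) M :=
      { toEquiv := E
        map_smul := hE_smul
        τnon_le := fun v a => by rw [hE]; exact (hτn_eq v a).le
        τarc_le := fun v a => by rw [hE]; exact (hτa_eq v a).le }
    let e₂ : MulLineBundle.Hom M (Φ L) :=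
      { toEquiv := E.symm
        map_smul := hEsymm_smul
        τnon_le := fun v s => by
          change M.τnon v s ≤ τn L v (E.symm s)
          rw [hτn_eq v, ← hE, Equiv.apply_symm_apply]
        τarc_le := fun v s => by
          change M.τarc v s ≤ τa L v (E.symm s)
          rw [hτa_eq v, ← hE, Equiv.apply_symm_apply] }
    refine ⟨L, e₁, e₂, ?_, ?_⟩
    · exact Equiv.self_trans_symm E
    · exact Equiv.symm_trans_self E

end Literature.AnabelianGeometry.AbsoluteAnabelian
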